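import Summits.QuantumFields.BalabanUV.Beta.EriceRemainderEnclosureHistoryAutonomyComparisonAgeCompositionOldPairCap
import Summits.QuantumFields.BalabanUV.Beta.EriceRemainderEnclosureHistoryAutonomyComparisonAgeCompositionClusterLevels
import Summits.QuantumFields.BalabanUV.Beta.EriceRemainderEnclosureHistoryAutonomyComparisonAgeCompositionYoungPairCapSeparatedAges

/-!
# EriceRemainderEnclosureHistoryAutonomyComparisonAgeCompositionNearPairSeparatedAges — (E99d) route (N), first order: NEAR OLD PAIRS AS CASCADE LEVELS.
# Gen 85∕86 typed the END `0 ≤ ε ≤ e` along every admissible flow for the census young pair `{1, k₂}` (every `k₂`) below a ×61 chain of SINGLE old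
# ages, and for any number of single ages in ×58 separation; a NEAR pair among the older ages (`k_{j+1} < 58k_j`) was open ((β) of README g85 §4).
# With the old-pair cap (E99b) `near_pair_load_le` (`Σ_{k∈{lo,hi}} x_k ≤ 0.617` for `56 ≤ lo ≤ hi ≤ 2lo`) and the cluster form (E99c)
# `flow_nonneg_cluster_levels_of_caps`, every older level may now be a NEAR OLD PAIR `{a_j, p_j}`, `a_j ≤ p_j ≤ 2a_j` (a single age when `p_j = a_j`),
# the chain condition reading `61·p_j ≤ a_{j+1}` (window of the pair below the youngest age of the next level):
# **`flow_nonneg_near_pair_levels_of_cap`** (parametric: ANY youngest cluster `S₀` with a typed cap `s₀`, `s₀(1+κ) ≤ 1`, closure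
# `κ + 4·0.617(1+κ) ≤ R₀(1 − 0.617(1+κ))κ`), **`flow_nonneg_census_young_pair_near_pairs`** (`S₀ = {1,k₂}`, `2 ≤ k₂ ≤ 29`, cap `0.8333` of (E97c),
# `κ = 1∕5`, ×61: `3.1616 ≤ 3.16712`), **`flow_nonneg_young_age_near_pairs`** (`S₀ = {a₀}`, ANY `a₀ ≥ 1`, cap `0.7072`, `κ = 1∕4`, ×59), and the census
# four ages `{1, k₂, k₃, k₄}` with a NEAR OLD PAIR ON TOP: `k₃ < k₄ ≤ 2k₃`, `61k₂ ≤ k₃`, for `2 ≤ k₂ ≤ 29` (**`flow_nonneg_census_four_ages_near_old_pair`**)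
# and for `k₂ ≥ 59` (`59k₂ ≤ k₃`, **`flow_nonneg_census_four_ages_near_old_pair_far`**; `30 ≤ k₂ ≤ 58` needs the youngest-gap engine (E96a), not here)

Cell `pub-balaban`, β-function sub-cell, BINDER row D4 «RemainderConst leaves for Bałaban's split» (`HOME/BINDER-OWNERS.md`; owner lineage `b2b-balaban-beta-an4`;
this file by co-owner #2 lineage `b2b-balaban-beta-d4-p2`, generation 87), β-FLOW TEAM duty (1), FREEZE (0) honoured (def-free; nothing restated).

HONEST FRAMING (page 1, verbatim and binding).  *"Discharging BetaPertH makes Bałaban's UV stability UNCONDITIONAL — a real constructive-QFT result; it is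
NOT the continuum limit and NOT the Clay problem."*  THIS FILE DISCHARGES NOTHING OF THE KIND.  Elementary real algebra ∕ real analysis about ABSTRACT
functionals on a box ]0,γ]^ℕ with displayed floors, profiles and signs, and the FIRST-ORDER renewal objects of route (N) built from them — hypotheses of a
census, not facts; the form, signs, ages and moments of Bałaban's (1.22) limit functional are NOT PRINTED ([I] p. 298; GAPS G-t4-U2-1∕-2) and NOT asserted.
Row D4 class UNCHANGED (critical-path width 0; instance 0∕1; D4 DISCHARGE NO DATE).  HONEST DEPENDENCY: continuum YM on T⁴ ⇐ BetaPertH ∧ nine spine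
estimates (0/9 proved); BetaPertH ⇐ (D1) ∧ (D4) ∧ CAP+tail; G-an2-4 gates asym, D1 and NE2/3/4.

THE POINT (README `HOME/b2b-balaban-beta-d4-p2/g87/README.md` §3).  A near old pair exports exactly what a single old age exports: window `hi = p`, youngest
`lo = a`, mass `≤ 0.617` (one age: `0.6142`), rate `4(c_a + c_p)` with `lo·ν ≤ 4x` — so the closure of the ×61 chain is UNCHANGED (`κ = 1∕5`:
`0.2 + 4·0.617·1.2 = 3.1616 ≤ 61·(1 − 0.7404)·0.2 = 3.16712`).  Uses (E99c) `flow_nonneg_cluster_levels_of_caps`, (E99b) `near_pair_load_le`, (E97c)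
`young_pair_load_le`, (E94b) `load_le_of_sq` BY NAME.  NOT CLAIMED: spans `p_j > 2a_j`; the census young pair with `30 ≤ k₂ ≤ 58` under a near old pair;
anything printed — NOT B12 Thm 2, NOT BetaPertH, NOT continuum, NOT Clay.

WHAT IS PROVED ([folklore]; 0 `def`, 0 sorry).  §1 **`flow_nonneg_near_pair_levels_of_cap`**.  §2 **`flow_nonneg_census_young_pair_near_pairs`**,
**`flow_nonneg_young_age_near_pairs`**.  §3 **`flow_nonneg_census_four_ages_near_old_pair`**, **`flow_nonneg_census_four_ages_near_old_pair_far`**.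
-/
noncomputable section
open Finset

namespace Summit.QuantumFields.BalabanUV.Beta.EriceRemainderEnclosureHistoryAutonomyComparisonAgeCompositionNearPairSeparatedAges

open Literature.MathematicalPhysics.QuantumFieldTheory.Balaban1983to89
open Literature.MathematicalPhysics.QuantumFieldTheory.Balaban1983to89.T4BetaStationary
open Literature.MathematicalPhysics.QuantumFieldTheory.Balaban1983to89.T4BetaFlowWellPosed
open Summit.QuantumFields.BalabanUV.Beta.EriceRemainderEnclosureHistoryAutonomyComparisonAgeCompositionYoungPairMoment (load_le_of_sq)
open Summit.QuantumFields.BalabanUV.Beta.EriceRemainderEnclosureHistoryAutonomyComparisonAgeCompositionOldPairCap (near_pair_load_le)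
open Summit.QuantumFields.BalabanUV.Beta.EriceRemainderEnclosureHistoryAutonomyComparisonAgeCompositionClusterLevels (flow_nonneg_cluster_levels_of_caps)
open Summit.QuantumFields.BalabanUV.Beta.EriceRemainderEnclosureHistoryAutonomyComparisonAgeCompositionYoungPairCapSeparatedAges (young_pair_load_le)

variable {B : (ℕ → ℝ) → ℝ} {γ b gIR : ℝ} {L : ℕ → ℝ} {K : ℕ} {h g : ℕ → ℝ}

/-! ## §1 Near old pairs above any capped youngest cluster (parametric) -/

/-- **NEAR OLD PAIRS AS LEVELS, PARAMETRIC FORM.**  Along every box solution of an isotone dominated memory with floor (`L ≥ 0`, `K ≥ 1` ages) and every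
damping of the self-consistent class: the youngest level is ANY cluster `S₀ ⊂ [1, K)` with window `hi₀` (`56 ≤ R₀·hi₀`) and a typed cap
`Σ_{k∈S₀} x_k(q) ≤ s₀`; the levels `1 ≤ j < r` are near old pairs `{a j, p j}`, `a j ≤ p j ≤ 2·a j` (`p j < K`; a single age when `p j = a j`), in
separation `R₀·hi₀ ≤ a 1`, `R₀·p j ≤ a (j+1)`; the profile vanishes off `S₀ ∪ ⋃_j {a j, p j}`; closure `κ > 0`, `s₀(1+κ) ≤ 1`, `0.617(1+κ) < 1`,
`κ + 4·0.617(1+κ) ≤ R₀(1 − 0.617(1+κ))κ`.  THEN `0 ≤ ε ≤ e` at every pin, every horizon, every `r ≥ 1` ((E99c) with the caps (E99b) `near_pair_load_le`).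
[folklore] -/
theorem flow_nonneg_near_pair_levels_of_cap
    (hmono : ∀ u v : ℕ → ℝ, SeqBox γ u → SeqBox γ v → (∀ j, u j ≤ v j) → B u ≤ B v)
    (hL : ∀ k, 0 ≤ L k) (hb : 0 < b) (hlo : ∀ u, SeqBox γ u → b ≤ B u) (hdom : ∀ u, SeqBox γ u → ∑ k ∈ range K, L k * u k ≤ B u)
    (hh : SeqBox γ h) (hf : MemFlow B gIR h) (hg : ∀ t, 0 < g t ∧ g t ≤ 1)
    (hgF : ∀ t, 1 ≤ g t * (1 + ∑ k ∈ range K, L k * h (t + k) ^ 3 / 2)) (hK : 1 ≤ K)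
    {κ s₀ : ℝ} {R₀ : ℕ} (hκ : 0 < κ) (hs₀C : s₀ * (1 + κ) ≤ 1) (hsC : (617 / 1000 : ℝ) * (1 + κ) < 1)
    (hR : κ + 4 * (617 / 1000 : ℝ) * (1 + κ) ≤ (R₀ : ℝ) * (1 - (617 / 1000 : ℝ) * (1 + κ)) * κ)
    {S₀ : Finset ℕ} {hi₀ : ℕ} (hS₀K : ∀ k ∈ S₀, 1 ≤ k ∧ k < K) (hS₀hi : ∀ k ∈ S₀, k ≤ hi₀) (hR56 : 56 ≤ R₀ * hi₀)
    (hcap0 : ∀ q, ∑ k ∈ S₀, (k : ℝ) * (L k * h (q + k) ^ 3 / 2) ≤ s₀)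
    {r : ℕ} {a p : ℕ → ℕ} (hr : 1 ≤ r) (hap : ∀ j, 1 ≤ j → j < r → a j ≤ p j ∧ p j ≤ 2 * a j) (hpK : ∀ j, 1 ≤ j → j < r → p j < K)
    (hsep0 : 1 < r → R₀ * hi₀ ≤ a 1) (hsep : ∀ j, 1 ≤ j → j + 1 < r → R₀ * p j ≤ a (j + 1))
    (hLa : ∀ l, l < K → l ∉ S₀ → (∀ j, 1 ≤ j → j < r → l ≠ a j ∧ l ≠ p j) → L l = 0)
    {N : ℕ} {KL : ℕ → ℕ → ℕ → ℝ}
    (hKL : ∀ k n l, KL k n l = if 0 < k ∧ k < K ∧ l < k then L k * h (n + k) ^ 3 / 2 * ∏ t ∈ Ico (n + 1 + l) (n + k + 1), g t else 0)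
    {KA : ℕ → ℕ → ℕ → ℝ} {RA : ℕ → (ℕ → ℝ) → ℕ → ℝ}
    (hRA : ∀ i v m, RA i v m = ∑ l ∈ range K, KA i m l * v (m + 1 + l))
    (hKA : ∀ i m l, KA i m l = KL i m l + KA (i + 1) m l) (hKAtop : ∀ m l, KA K m l = 0)
    {e ε : ℕ → ℝ} (he0 : ∀ m, 0 ≤ e m) (hea : ∀ m, e (m + 1) ≤ e m)
    (hεt : ∀ m, N < m → ε m = 0) (hεrec : ∀ m, ε m = e m - RA 1 ε m) : ∀ m, 0 ≤ ε m ∧ ε m ≤ e m := by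
  have hR0 : (0 : ℝ) < R₀ := by
    have h1 : 0 < κ + 4 * (617 / 1000 : ℝ) * (1 + κ) := by positivity
    by_contra h0
    have hle : (R₀ : ℝ) ≤ 0 := not_lt.mp h0
    have : (R₀ : ℝ) = 0 := le_antisymm hle (Nat.cast_nonneg R₀)
    rw [this] at hR; linarith
  have hR1 : 1 ≤ R₀ := by exact_mod_cast (show (0 : ℝ) < R₀ from hR0)
  -- the window of each level and the chain of separations
  obtain ⟨HI, hHI⟩ : ∃ HI : ℕ → ℕ, ∀ j, HI j = if j = 0 then hi₀ else p j := ⟨_, fun _ => rfl⟩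
  have hHI0 : HI 0 = hi₀ := by rw [hHI]; simp
  have hHIS : ∀ j, 1 ≤ j → HI j = p j := fun j hj => by rw [hHI, if_neg (by omega)]
  have hchain : ∀ i j, i < j → j < r → R₀ * HI i ≤ a j := by
    intro i j hij hjr
    induction j, hij using Nat.le_induction with
    | base =>
      rcases Nat.eq_zero_or_pos i with rfl | hi
      · rw [hHI0]; exact hsep0 (by omega)
      · rw [hHIS i hi]; exact hsep i hi (by omega)
    | succ j hle ih =>
      have h1 := ih (by omega)
      have h2 := hsep j (by omega) hjr
      have h3 := (hap j (by omega) (by omega)).1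
      have h4 : p j ≤ R₀ * p j := Nat.le_mul_of_pos_left _ (by omega)
      omega
  have ha56 : ∀ j, 1 ≤ j → j < r → 56 ≤ a j := by
    intro j hj hjr
    have := hchain 0 j (by omega) hjr
    rw [hHI0] at this; omega
  refine flow_nonneg_cluster_levels_of_caps hmono hL hb hlo hdom hh hf hg hgF hK hκ (by norm_num) hs₀C hsC hR
    (r := r) (S := fun j => if j = 0 then S₀ else {a j, p j}) (lo := fun j => if j = 0 then 1 else a j) (hi := HI)
    (fun j hj k hk => ?_) (fun j hj k hk => ?_) (fun j hj k hk => ?_) (fun j hj1 hjr => ?_) (fun j hj => ?_) (fun i j hij hjr => ?_)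
    (fun l hl hno => ?_) (fun q => ?_) (fun j q hj1 hjr => ?_) hKL hRA hKA hKAtop he0 hea hεt hεrec
  · -- members are ages in [1, K)
    by_cases hj0 : j = 0
    · subst hj0; simp only [if_true] at hk; exact hS₀K k hk
    · simp only [if_neg hj0, mem_insert, mem_singleton] at hk
      have h1 := ha56 j (by omega) hj; have h2 := hap j (by omega) hj; have h3 := hpK j (by omega) hj
      rcases hk with rfl | rfl <;> omega
  · -- members are ≥ lo
    by_cases hj0 : j = 0
    · subst hj0; simp only [if_true] at hk ⊢; exact (hS₀K k hk).1
    · simp only [if_neg hj0, mem_insert, mem_singleton] at hk ⊢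
      have h2 := hap j (by omega) hj
      rcases hk with rfl | rfl <;> omega
  · -- members are ≤ hi
    by_cases hj0 : j = 0
    · subst hj0; simp only [if_true] at hk; rw [hHI0]; exact hS₀hi k hk
    · simp only [if_neg hj0, mem_insert, mem_singleton] at hk
      rw [hHIS j (by omega)]
      have h2 := hap j (by omega) hj
      rcases hk with rfl | rfl <;> omega
  · -- lo ≤ hi for the older levels
    simp only [if_neg (show j ≠ 0 by omega)]
    rw [hHIS j hj1]; exact (hap j hj1 hjr).1
  · -- separation R₀·hi j ≤ lo (j+1) = a (j+1)
    simp only [if_neg (Nat.succ_ne_zero j)]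
    exact hchain j (j + 1) (by omega) hj
  · -- the clusters are pairwise disjoint: everything in level i lies below everything in level j
    have hlt : ∀ x, x ∈ (if i = 0 then S₀ else ({a i, p i} : Finset ℕ)) → ∀ y, y ∈ (if j = 0 then S₀ else ({a j, p j} : Finset ℕ)) → x < y := by
      intro x hx y hy
      have hj0 : j ≠ 0 := by omega
      simp only [if_neg hj0, mem_insert, mem_singleton] at hy
      have hc := hchain i j hij hjr
      have hay : a j ≤ y := by have := (hap j (by omega) hjr).1; rcases hy with rfl | rfl <;> omega
      have hxH : 1 ≤ x ∧ x ≤ HI i := by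
        by_cases hi0 : i = 0
        · subst hi0; simp only [if_true] at hx; rw [hHI0]; exact ⟨(hS₀K x hx).1, hS₀hi x hx⟩
        · simp only [if_neg hi0, mem_insert, mem_singleton] at hx
          rw [hHIS i (by omega)]
          have h1 := ha56 i (by omega) (by omega); have h2 := hap i (by omega) (by omega)
          rcases hx with rfl | rfl <;> omega
      have : HI i ≤ R₀ * HI i := Nat.le_mul_of_pos_left _ (by omega)
      rcases Nat.lt_or_ge (HI i) (R₀ * HI i) with h5 | h5
      · omega
      · -- R₀·HI i ≤ HI i forces nothing unless HI i = 0, excluded by 1 ≤ x ≤ HI i when R₀ ≥ 2; use 56 ≤ R₀·hi₀-type growth instead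
        have h6 : 2 * HI i ≤ R₀ * HI i := by
          have hR2 : 2 ≤ R₀ := by
            by_contra hR2
            have hR1' : R₀ = 1 := by omega
            rw [hR1'] at hR; norm_num at hR; nlinarith [hsC, hκ]
          exact Nat.mul_le_mul_right _ hR2
        omega
    exact disjoint_left.mpr fun x hx hx' => lt_irrefl x (hlt x hx x hx')
  · -- the profile vanishes off the clusters
    refine hLa l hl (by simpa using hno 0 (by omega)) fun j hj1 hjr => ?_
    have := hno j hjr
    simp only [if_neg (show j ≠ 0 by omega), mem_insert, mem_singleton, not_or] at this
    exact this
  · -- the youngest cap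
    simp only [if_true]; exact hcap0 q
  · -- the older caps: (E99b)
    simp only [if_neg (show j ≠ 0 by omega)]
    have h2 := hap j hj1 hjr
    exact near_pair_load_le hmono hL hb hlo hdom hh hf (ha56 j hj1 hjr) h2.1 h2.2 (hpK j hj1 hjr) q

/-! ## §2 The census young pair, or any young age, below a chain of near old pairs -/

/-- **THE CENSUS YOUNG PAIR `{1, k₂}`, `2 ≤ k₂ ≤ 29`, BELOW A ×61 CHAIN OF NEAR OLD PAIRS, ANY NUMBER OF LEVELS.**  Profile carried by
`{1, k₂} ∪ ⋃_{1≤j<r} {a j, p j}` with `a j ≤ p j ≤ 2·a j`, `61k₂ ≤ a 1`, `61·p j ≤ a (j+1)`: `0 ≤ ε ≤ e` at every pin, every horizon, every damping of the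
self-consistent class (`κ = 1∕5`, caps `0.8333` (E97c) and `0.617` (E99b), `R₀ = 61`: `3.1616 ≤ 3.16712`). [folklore] -/
theorem flow_nonneg_census_young_pair_near_pairs
    (hmono : ∀ u v : ℕ → ℝ, SeqBox γ u → SeqBox γ v → (∀ j, u j ≤ v j) → B u ≤ B v)
    (hL : ∀ k, 0 ≤ L k) (hb : 0 < b) (hlo : ∀ u, SeqBox γ u → b ≤ B u) (hdom : ∀ u, SeqBox γ u → ∑ k ∈ range K, L k * u k ≤ B u)
    (hh : SeqBox γ h) (hf : MemFlow B gIR h) (hg : ∀ t, 0 < g t ∧ g t ≤ 1)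
    (hgF : ∀ t, 1 ≤ g t * (1 + ∑ k ∈ range K, L k * h (t + k) ^ 3 / 2))
    {k₂ : ℕ} (hk2 : 2 ≤ k₂) (hk29 : k₂ ≤ 29) (hk2K : k₂ < K)
    {r : ℕ} {a p : ℕ → ℕ} (hr : 1 ≤ r) (hap : ∀ j, 1 ≤ j → j < r → a j ≤ p j ∧ p j ≤ 2 * a j) (hpK : ∀ j, 1 ≤ j → j < r → p j < K)
    (hsep0 : 1 < r → 61 * k₂ ≤ a 1) (hsep : ∀ j, 1 ≤ j → j + 1 < r → 61 * p j ≤ a (j + 1))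
    (hLa : ∀ l, l < K → l ≠ 1 → l ≠ k₂ → (∀ j, 1 ≤ j → j < r → l ≠ a j ∧ l ≠ p j) → L l = 0)
    {N : ℕ} {KL : ℕ → ℕ → ℕ → ℝ}
    (hKL : ∀ k n l, KL k n l = if 0 < k ∧ k < K ∧ l < k then L k * h (n + k) ^ 3 / 2 * ∏ t ∈ Ico (n + 1 + l) (n + k + 1), g t else 0)
    {KA : ℕ → ℕ → ℕ → ℝ} {RA : ℕ → (ℕ → ℝ) → ℕ → ℝ}
    (hRA : ∀ i v m, RA i v m = ∑ l ∈ range K, KA i m l * v (m + 1 + l))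
    (hKA : ∀ i m l, KA i m l = KL i m l + KA (i + 1) m l) (hKAtop : ∀ m l, KA K m l = 0)
    {e ε : ℕ → ℝ} (he0 : ∀ m, 0 ≤ e m) (hea : ∀ m, e (m + 1) ≤ e m)
    (hεt : ∀ m, N < m → ε m = 0) (hεrec : ∀ m, ε m = e m - RA 1 ε m) : ∀ m, 0 ≤ ε m ∧ ε m ≤ e m := by
  refine flow_nonneg_near_pair_levels_of_cap hmono hL hb hlo hdom hh hf hg hgF (by omega) (κ := 1 / 5) (s₀ := 8333 / 10000) (R₀ := 61)
    (by norm_num) (by norm_num) (by norm_num) (by norm_num) (S₀ := {1, k₂}) (hi₀ := k₂)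
    (fun k hk => ?_) (fun k hk => ?_) (by omega) (fun q => ?_) hr hap hpK hsep0 hsep (fun l hl hl0 hno => ?_) hKL hRA hKA hKAtop he0 hea hεt hεrec
  · simp only [mem_insert, mem_singleton] at hk; rcases hk with rfl | rfl <;> omega
  · simp only [mem_insert, mem_singleton] at hk; rcases hk with rfl | rfl <;> omega
  · rw [sum_pair (show (1 : ℕ) ≠ k₂ by omega), Nat.cast_one, one_mul]
    exact young_pair_load_le hmono hL hb hlo hdom hh hf hk2 hk29 hk2K q
  · refine hLa l hl (fun h1 => hl0 ?_) (fun h2 => hl0 ?_) hno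
    · rw [h1]; exact mem_insert_self _ _
    · rw [h2]; exact mem_insert_of_mem (mem_singleton_self _)

/-- **ANY YOUNG AGE BELOW A ×59 CHAIN OF NEAR OLD PAIRS, ANY NUMBER OF LEVELS.**  Profile carried by `{a₀} ∪ ⋃_{1≤j<r} {a j, p j}` with `a₀ ≥ 1`
ARBITRARY, `a j ≤ p j ≤ 2·a j`, `59a₀ ≤ a 1`, `59·p j ≤ a (j+1)`: `0 ≤ ε ≤ e` at every pin (`κ = 1∕4`, caps `0.7072` ((E94b) `load_le_of_sq`, any age) and
`0.617`, `R₀ = 59`: `3.335 ≤ 3.374`). [folklore] -/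
theorem flow_nonneg_young_age_near_pairs
    (hmono : ∀ u v : ℕ → ℝ, SeqBox γ u → SeqBox γ v → (∀ j, u j ≤ v j) → B u ≤ B v)
    (hL : ∀ k, 0 ≤ L k) (hb : 0 < b) (hlo : ∀ u, SeqBox γ u → b ≤ B u) (hdom : ∀ u, SeqBox γ u → ∑ k ∈ range K, L k * u k ≤ B u)
    (hh : SeqBox γ h) (hf : MemFlow B gIR h) (hg : ∀ t, 0 < g t ∧ g t ≤ 1)
    (hgF : ∀ t, 1 ≤ g t * (1 + ∑ k ∈ range K, L k * h (t + k) ^ 3 / 2))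
    {a₀ : ℕ} (ha0 : 1 ≤ a₀) (ha0K : a₀ < K)
    {r : ℕ} {a p : ℕ → ℕ} (hr : 1 ≤ r) (hap : ∀ j, 1 ≤ j → j < r → a j ≤ p j ∧ p j ≤ 2 * a j) (hpK : ∀ j, 1 ≤ j → j < r → p j < K)
    (hsep0 : 1 < r → 59 * a₀ ≤ a 1) (hsep : ∀ j, 1 ≤ j → j + 1 < r → 59 * p j ≤ a (j + 1))
    (hLa : ∀ l, l < K → l ≠ a₀ → (∀ j, 1 ≤ j → j < r → l ≠ a j ∧ l ≠ p j) → L l = 0)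
    {N : ℕ} {KL : ℕ → ℕ → ℕ → ℝ}
    (hKL : ∀ k n l, KL k n l = if 0 < k ∧ k < K ∧ l < k then L k * h (n + k) ^ 3 / 2 * ∏ t ∈ Ico (n + 1 + l) (n + k + 1), g t else 0)
    {KA : ℕ → ℕ → ℕ → ℝ} {RA : ℕ → (ℕ → ℝ) → ℕ → ℝ}
    (hRA : ∀ i v m, RA i v m = ∑ l ∈ range K, KA i m l * v (m + 1 + l))
    (hKA : ∀ i m l, KA i m l = KL i m l + KA (i + 1) m l) (hKAtop : ∀ m l, KA K m l = 0)
    {e ε : ℕ → ℝ} (he0 : ∀ m, 0 ≤ e m) (hea : ∀ m, e (m + 1) ≤ e m)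
    (hεt : ∀ m, N < m → ε m = 0) (hεrec : ∀ m, ε m = e m - RA 1 ε m) : ∀ m, 0 ≤ ε m ∧ ε m ≤ e m := by
  refine flow_nonneg_near_pair_levels_of_cap hmono hL hb hlo hdom hh hf hg hgF (by omega) (κ := 1 / 4) (s₀ := 7072 / 10000) (R₀ := 59)
    (by norm_num) (by norm_num) (by norm_num) (by norm_num) (S₀ := {a₀}) (hi₀ := a₀)
    (fun k hk => ?_) (fun k hk => ?_) (by omega) (fun q => ?_) hr hap hpK hsep0 hsep (fun l hl hl0 hno => ?_) hKL hRA hKA hKAtop he0 hea hεt hεrec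
  · rw [mem_singleton] at hk; subst hk; exact ⟨ha0, ha0K⟩
  · rw [mem_singleton] at hk; omega
  · rw [sum_singleton]
    have ha0r : (1 : ℝ) ≤ a₀ := by exact_mod_cast ha0
    exact load_le_of_sq hmono hL hb hlo hdom hh hf ha0 ha0K (so := 7072 / 10000) (by norm_num) (by nlinarith) q
  · exact hLa l hl (fun h1 => hl0 (by rw [h1]; exact mem_singleton_self _)) hno

/-! ## §3 The census four ages with a near old pair on top -/

/-- **THE CENSUS FOUR AGES `{1, k₂, k₃, k₄}` WITH A NEAR OLD PAIR: `2 ≤ k₂ ≤ 29`, `61k₂ ≤ k₃`, `k₃ < k₄ ≤ 2k₃`.**  `0 ≤ ε ≤ e` at every pin, every horizon,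
every damping of the self-consistent class (`flow_nonneg_census_young_pair_near_pairs` with one older level `{k₃, k₄}`). [folklore] -/
theorem flow_nonneg_census_four_ages_near_old_pair
    (hmono : ∀ u v : ℕ → ℝ, SeqBox γ u → SeqBox γ v → (∀ j, u j ≤ v j) → B u ≤ B v)
    (hL : ∀ k, 0 ≤ L k) (hb : 0 < b) (hlo : ∀ u, SeqBox γ u → b ≤ B u) (hdom : ∀ u, SeqBox γ u → ∑ k ∈ range K, L k * u k ≤ B u)
    (hh : SeqBox γ h) (hf : MemFlow B gIR h) (hg : ∀ t, 0 < g t ∧ g t ≤ 1)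
    (hgF : ∀ t, 1 ≤ g t * (1 + ∑ k ∈ range K, L k * h (t + k) ^ 3 / 2))
    {k₂ k₃ k₄ : ℕ} (hk2 : 2 ≤ k₂) (hk29 : k₂ ≤ 29) (hk3 : 61 * k₂ ≤ k₃) (hk34 : k₃ < k₄) (hk4 : k₄ ≤ 2 * k₃) (hk4K : k₄ < K)
    (hLa : ∀ l, l < K → l ≠ 1 → l ≠ k₂ → l ≠ k₃ → l ≠ k₄ → L l = 0)
    {N : ℕ} {KL : ℕ → ℕ → ℕ → ℝ}
    (hKL : ∀ k n l, KL k n l = if 0 < k ∧ k < K ∧ l < k then L k * h (n + k) ^ 3 / 2 * ∏ t ∈ Ico (n + 1 + l) (n + k + 1), g t else 0)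
    {KA : ℕ → ℕ → ℕ → ℝ} {RA : ℕ → (ℕ → ℝ) → ℕ → ℝ}
    (hRA : ∀ i v m, RA i v m = ∑ l ∈ range K, KA i m l * v (m + 1 + l))
    (hKA : ∀ i m l, KA i m l = KL i m l + KA (i + 1) m l) (hKAtop : ∀ m l, KA K m l = 0)
    {e ε : ℕ → ℝ} (he0 : ∀ m, 0 ≤ e m) (hea : ∀ m, e (m + 1) ≤ e m)
    (hεt : ∀ m, N < m → ε m = 0) (hεrec : ∀ m, ε m = e m - RA 1 ε m) : ∀ m, 0 ≤ ε m ∧ ε m ≤ e m := by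
  refine flow_nonneg_census_young_pair_near_pairs hmono hL hb hlo hdom hh hf hg hgF hk2 hk29 (by omega)
    (r := 2) (a := fun _ => k₃) (p := fun _ => k₄) (by norm_num) (fun j _ _ => ⟨hk34.le, hk4⟩) (fun j _ _ => hk4K)
    (fun _ => hk3) (fun j hj hj2 => by omega) (fun l hl h1 h2 hno => ?_) hKL hRA hKA hKAtop he0 hea hεt hεrec
  have := hno 1 le_rfl (by norm_num)
  exact hLa l hl h1 h2 this.1 this.2

/-- **THE CENSUS FOUR AGES `{1, k₂, k₃, k₄}` WITH A NEAR OLD PAIR, FAR YOUNG PART: `k₂ ≥ 59`, `59k₂ ≤ k₃`, `k₃ < k₄ ≤ 2k₃`.**  `0 ≤ ε ≤ e` at every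
pin (`flow_nonneg_young_age_near_pairs` with `a₀ = 1`, the single level `{k₂}` and the pair `{k₃, k₄}`).  (`30 ≤ k₂ ≤ 58` is not covered here.) [folklore] -/
theorem flow_nonneg_census_four_ages_near_old_pair_far
    (hmono : ∀ u v : ℕ → ℝ, SeqBox γ u → SeqBox γ v → (∀ j, u j ≤ v j) → B u ≤ B v)
    (hL : ∀ k, 0 ≤ L k) (hb : 0 < b) (hlo : ∀ u, SeqBox γ u → b ≤ B u) (hdom : ∀ u, SeqBox γ u → ∑ k ∈ range K, L k * u k ≤ B u)
    (hh : SeqBox γ h) (hf : MemFlow B gIR h) (hg : ∀ t, 0 < g t ∧ g t ≤ 1)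
    (hgF : ∀ t, 1 ≤ g t * (1 + ∑ k ∈ range K, L k * h (t + k) ^ 3 / 2))
    {k₂ k₃ k₄ : ℕ} (hk2 : 59 ≤ k₂) (hk3 : 59 * k₂ ≤ k₃) (hk34 : k₃ < k₄) (hk4 : k₄ ≤ 2 * k₃) (hk4K : k₄ < K)
    (hLa : ∀ l, l < K → l ≠ 1 → l ≠ k₂ → l ≠ k₃ → l ≠ k₄ → L l = 0)
    {N : ℕ} {KL : ℕ → ℕ → ℕ → ℝ}
    (hKL : ∀ k n l, KL k n l = if 0 < k ∧ k < K ∧ l < k then L k * h (n + k) ^ 3 / 2 * ∏ t ∈ Ico (n + 1 + l) (n + k + 1), g t else 0)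
    {KA : ℕ → ℕ → ℕ → ℝ} {RA : ℕ → (ℕ → ℝ) → ℕ → ℝ}
    (hRA : ∀ i v m, RA i v m = ∑ l ∈ range K, KA i m l * v (m + 1 + l))
    (hKA : ∀ i m l, KA i m l = KL i m l + KA (i + 1) m l) (hKAtop : ∀ m l, KA K m l = 0)
    {e ε : ℕ → ℝ} (he0 : ∀ m, 0 ≤ e m) (hea : ∀ m, e (m + 1) ≤ e m)
    (hεt : ∀ m, N < m → ε m = 0) (hεrec : ∀ m, ε m = e m - RA 1 ε m) : ∀ m, 0 ≤ ε m ∧ ε m ≤ e m := by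
  refine flow_nonneg_young_age_near_pairs hmono hL hb hlo hdom hh hf hg hgF (a₀ := 1) le_rfl (by omega)
    (r := 3) (a := fun j => if j = 1 then k₂ else k₃) (p := fun j => if j = 1 then k₂ else k₄) (by norm_num)
    (fun j hj1 hj3 => ?_) (fun j hj1 hj3 => ?_) (fun _ => by simpa using hk2) (fun j hj1 hj3 => ?_) (fun l hl h1 hno => ?_)
    hKL hRA hKA hKAtop he0 hea hεt hεrec
  · by_cases hj : j = 1
    · simp only [hj, if_true]; omega
    · simp only [if_neg hj]; omega
  · by_cases hj : j = 1
    · simp only [hj, if_true]; omega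
    · simp only [if_neg hj]; exact hk4K
  · have hj : j = 1 := by omega
    subst hj; simp only [if_true, show (1 + 1 : ℕ) ≠ 1 by norm_num, if_false]; omega
  · have h2 := hno 1 le_rfl (by norm_num)
    have h3 := hno 2 (by norm_num) (by norm_num)
    simp only [if_true] at h2
    simp only [show (2 : ℕ) ≠ 1 by norm_num, if_false] at h3
    exact hLa l hl h1 h2.1 h3.1 h3.2

end Summit.QuantumFields.BalabanUV.Beta.EriceRemainderEnclosureHistoryAutonomyComparisonAgeCompositionNearPairSeparatedAges
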